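import Literature.Probability.LatticeModels.LatticeHarmonicMeasure
import HarnessLib

/-!
# Weak Beurling decay at a flat boundary point (straight exterior ray as the cut)

Topic `Literature/Probability/LatticeModels` (discrete potential theory on `ℤ²`; the boundary-value
step "`H = 0` on `∂Ω ∖ {a}`" in D. Chelkak, S. Smirnov, *Discrete complex analysis on isoradial
graphs*, Adv. Math. 228 (2011), proofs of Thms. 3.10 and 3.13, square-lattice case with flat
boundary, where the exterior cut is the straight normal ray; it feeds the tree fact
`ChelkakSmirnov2011_boundaryNormalisedPoissonKernelLimit`).

* `exists_rayWalk` — the straight lattice walk `p, p + e_k, …, p + K e_k` (vertices on the ray).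
* **`le_rpow_of_flat_ray`** — let `V ⊆ ℤ²` be finite, `p` a point from which the ray `p + j e_k`,
  `j ≤ R + 1`, stays outside `V`, and `h` subharmonic on `V ∩ sqBox p R'` (`R ≤ R'`) with `h ≤ 1`
  on the outer boundary of that set and `h ≤ 0` off `V`. Then on `V ∩ sqBox p ρ` (`ρ ≤ R'`)
  `h ≤ C ((ρ+1)/(R+1))^β` with `C = beurlingConst`, `β = beurlingExp` — Smirnov's weak Beurling
  estimate `LatticeHarmonicMeasure.le_add_rpow_of_cutPath` with the straight cut.

Everything is proved, [folklore] given the cited weak Beurling estimate.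
-/

noncomputable section

namespace Literature.Probability.LatticeModels

open Set WeakBeurling

/-- **The straight lattice walk** `p, p + e_k, …, p + K e_k` exists, with vertices on the ray. [folklore] -/
theorem exists_rayWalk (k : Fin 4) :
    ∀ (K : ℕ) (p : Site 2), ∃ q : (zdGraph 2).Walk p (p + K • cornerUnit k),
      ∀ z ∈ q.support, ∃ j : ℕ, j ≤ K ∧ z = p + j • cornerUnit k := by
  intro K
  induction K with
  | zero =>
    intro p
    refine ⟨(SimpleGraph.Walk.nil : (zdGraph 2).Walk p p).copy rfl (by rw [zero_nsmul, add_zero]), ?_⟩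
    intro z hz
    simp only [SimpleGraph.Walk.support_copy, SimpleGraph.Walk.support_nil, List.mem_singleton] at hz
    exact ⟨0, le_rfl, by rw [hz, zero_nsmul, add_zero]⟩
  | succ K ih =>
    intro p
    obtain ⟨q, hq⟩ := ih (p + cornerUnit k)
    refine ⟨(SimpleGraph.Walk.cons (Literature.Probability.Percolation.adj_of_stepKind (stepKind_add_cornerUnit p k))
      q).copy rfl (by rw [succ_nsmul', add_assoc, add_comm (cornerUnit k)]), ?_⟩
    intro z hz
    simp only [SimpleGraph.Walk.support_copy, SimpleGraph.Walk.support_cons, List.mem_cons] at hz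
    rcases hz with hz | hz
    · exact ⟨0, by omega, by rw [hz, zero_nsmul, add_zero]⟩
    · obtain ⟨j, hj, rfl⟩ := hq z hz
      exact ⟨j + 1, by omega, by rw [succ_nsmul', add_assoc]⟩

/-- **Weak Beurling decay at a flat boundary point** (the boundary-value step "`H = 0` on
`∂Ω ∖ {a}`" of Chelkak–Smirnov's proofs of Thms. 3.10/3.13, square lattice, flat boundary point,
with the straight exterior ray as the cut): let `V ⊆ ℤ²` be finite, `p` a point from which the ray
`p + j e_k`, `j ≤ R + 1`, stays outside `V` (at a flat boundary stretch: the normal ray into the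
complement), and `h` subharmonic on `V ∩ sqBox p R'` (`R ≤ R'`) with `h ≤ 1` on the outer boundary
of that set and `h ≤ 0` off `V`. Then on `V ∩ sqBox p ρ`, `ρ ≤ R'`,
`h ≤ C ((ρ+1)/(R+1))^β` (`le_add_rpow_of_cutPath`, constants `C = beurlingConst`,
`β = beurlingExp`). [cite: ChelkakSmirnov2011, proof of Thm. 3.10 (boundary values); Smirnov2010, Appendix B, Lemma B.3] -/
theorem le_rpow_of_flat_ray {V : Finset (Site 2)} {p : Site 2} {k : Fin 4} {R R' ρ : ℕ} (hRR' : R ≤ R')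
    (hray : ∀ j : ℕ, j ≤ R + 1 → p + j • cornerUnit k ∉ V)
    {h : Site 2 → ℝ} (hh : IsLatticeSubharmonicOn h ((↑V : Set (Site 2)) ∩ sqBox p R'))
    (h1 : ∀ w ∈ latticeOuterBoundary ((↑V : Set (Site 2)) ∩ sqBox p R'), h w ≤ 1)
    (h0 : ∀ w : Site 2, w ∉ V → h w ≤ 0)
    {z : Site 2} (hzV : z ∈ V) (hz : z ∈ sqBox p ρ) (hρ : ρ ≤ R') :
    h z ≤ beurlingConst * (((ρ : ℝ) + 1) / ((R : ℝ) + 1)) ^ beurlingExp := by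
  set T : Set (Site 2) := (↑V : Set (Site 2)) ∩ sqBox p R' with hT
  have hTfin : T.Finite := V.finite_toSet.subset inter_subset_left
  -- the straight cut
  have hd : p + (R + 1) • cornerUnit k ∉ sqBox p R := by
    intro hmem
    obtain ⟨h0', h1'⟩ := hmem
    fin_cases k <;> simp [cornerUnit, Pi.add_apply, abs_le] at h0' h1'
  obtain ⟨q, hqs⟩ := exists_rayWalk k (R + 1) p
  have hq : ∀ w ∈ q.support, w ∉ T := by
    intro w hw hwT
    obtain ⟨j, hj, rfl⟩ := hqs w hw
    exact hray j hj (Finset.mem_coe.1 hwT.1)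
  -- boundary data: `≤ 0` on the killed points inside the box
  have hη : ∀ w ∈ latticeOuterBoundary T, w ∈ sqBox p R → h w ≤ 0 := by
    intro w hw hwR
    have hwT : w ∉ T := hw.1
    have hwV : w ∉ V := fun hwV => hwT ⟨Finset.mem_coe.2 hwV, sqBox_mono p (by exact_mod_cast hRR') hwR⟩
    exact h0 w hwV
  have hzT : z ∈ T := ⟨Finset.mem_coe.2 hzV, sqBox_mono p (by exact_mod_cast hρ) hz⟩
  have key := le_add_rpow_of_cutPath hTfin hh h1 le_rfl hη q hd hq hzT hz
  linarith

/-- **Scaled form.** Under the same straight-ray hypothesis, a function `P` subharmonic on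
`V ∩ sqBox p R'`, `≤ A` on the outer boundary of that set (`0 < A`) and `≤ 0` off `V`, satisfies
`P ≤ A · C ((ρ+1)/(R+1))^β` on `V ∩ sqBox p ρ` (apply `le_rpow_of_flat_ray` to `P / A`). [folklore] -/
theorem le_mul_rpow_of_flat_ray {V : Finset (Site 2)} {p : Site 2} {k : Fin 4} {R R' ρ : ℕ} (hRR' : R ≤ R')
    (hray : ∀ j : ℕ, j ≤ R + 1 → p + j • cornerUnit k ∉ V)
    {P : Site 2 → ℝ} (hP : IsLatticeSubharmonicOn P ((↑V : Set (Site 2)) ∩ sqBox p R'))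
    {A : ℝ} (hA : 0 < A) (h1 : ∀ w ∈ latticeOuterBoundary ((↑V : Set (Site 2)) ∩ sqBox p R'), P w ≤ A)
    (h0 : ∀ w : Site 2, w ∉ V → P w ≤ 0)
    {z : Site 2} (hzV : z ∈ V) (hz : z ∈ sqBox p ρ) (hρ : ρ ≤ R') :
    P z ≤ A * (beurlingConst * (((ρ : ℝ) + 1) / ((R : ℝ) + 1)) ^ beurlingExp) := by
  have hsub : IsLatticeSubharmonicOn (fun w => P w / A) ((↑V : Set (Site 2)) ∩ sqBox p R') := by
    intro x hx
    have hlin : latticeLaplacian (fun w => P w / A) x = latticeLaplacian P x / A := by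
      simp only [latticeLaplacian, Finset.sum_div, sub_div]
    rw [hlin]
    exact div_nonneg (hP x hx) hA.le
  have key := le_rpow_of_flat_ray hRR' hray hsub (fun w hw => (div_le_one hA).2 (h1 w hw))
    (fun w hw => div_nonpos_of_nonpos_of_nonneg (h0 w hw) hA.le) hzV hz hρ
  rwa [div_le_iff₀' hA] at key

end Literature.Probability.LatticeModels
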